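import Summits.QuantumAdvantage.QuantumAdvantage.Theorems.CubicForrelationNearExactIsExactCubicFormCellL2
import Summits.QuantumAdvantage.QuantumAdvantage.Theorems.CubicForrelationNearExactIsExactCubicFormMixedThird

/-!
# Crux `CubicForrelation.NearExactIsExact` (stmt-QuantumAdvantage-14043) — LIGHT STRUCTURE of the cells: the mixed slices `G|_{H×H}`,
  `Γ|_{H×H}` are multiples of `ω` (the `hG`/`hΓ` hypotheses of the ω₆/ω₈ leaves, on the Boolean side)

Certificate seat `b2b-cforr-cert` (gen 41).  HONEST FRAMING: kernel-checked assembly (standard axioms) of …CubicFormCellL2 (`tl2_*`),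
…CubicFormMixedThird (`tcm_mixed_third`), …CubicFormCells (`tcc_third_rho`) and …CubicForm (`tcf_third_const`): step (3) of
HOME/b2b-cforr-cert-g41/ASSEMBLY-BLUEPRINT-W8.md.  For a cubic `κ` on `3 + (1 + 8)` bits whose light cell `ρ₀ = κ(v₀, ·)` has cubic form
`s₀ ∧ ω_{2h}` (`3 ≤ h`, the output format of …CubicFormLightCoords) and vanishes on the half `s₀ = ¬b` (it is supported in the Kasami–Tokura
hyperplane `s₀ = b`), and for a neighbouring cell `κ(v₀ ⊕ e_t, ·)` with fewer than `160` ones, the mixed third differences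
`t̄(e_t, e_{4+σ}, e_{4+τ})` (`σ, τ < 8`, the `H × H` block of the slice at `e_t`) equal `ε · ω(e_σ, e_τ)` for one `ε ∈ 𝔽₂`.
Nothing about `θ₁₂`; NOT summit progress.

* `tls_cells_third`: all cells of a cubic have the same third differences (all arguments, all base points).
* `tls_light_structure` (**main**).

References: E1280-HANDPROOFS.md App. A.4 (cell lemma L2); F. J. MacWilliams, N. J. A. Sloane (1977) Ch. 15 §2.  Axioms: the standard three.
-/

set_option linter.dupNamespace false -- D-0017: single-problem summit ⇒ `QuantumAdvantage.QuantumAdvantage` by design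

namespace Summit.QuantumAdvantage.QuantumAdvantage.Theorems.CubicForrelation.NearExactIsExact

open Finset
open Literature.Computability.QuantumComplexity
open Literature.Computability.QuantumComplexity.BuzetChailloux (bxor zeroVec bxor_comm bxor_self bxor_zeroVec zeroVec_bxor
  bxor_bxor_cancel_left)

/-- **All cells of a cubic have the same third differences.** [folklore] -/
theorem tls_cells_third {m : ℕ} (κ : (Fin (3 + m) → Bool) → Bool) (hκ : IsDegLeFun 3 κ) (v v' : Fin 3 → Bool)
    (u₁ u₂ u₃ x x' : Fin m → Bool) :
    let ρ : (Fin m → Bool) → Bool := fun s => κ (Fin.append v s)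
    let ρ' : (Fin m → Bool) → Bool := fun s => κ (Fin.append v' s)
    (((ρ x ^^ ρ (bxor x u₃)) ^^ (ρ (bxor x u₂) ^^ ρ (bxor (bxor x u₂) u₃))) ^^
        ((ρ (bxor x u₁) ^^ ρ (bxor (bxor x u₁) u₃)) ^^ (ρ (bxor (bxor x u₁) u₂) ^^ ρ (bxor (bxor (bxor x u₁) u₂) u₃)))) =
      (((ρ' x' ^^ ρ' (bxor x' u₃)) ^^ (ρ' (bxor x' u₂) ^^ ρ' (bxor (bxor x' u₂) u₃))) ^^
        ((ρ' (bxor x' u₁) ^^ ρ' (bxor (bxor x' u₁) u₃)) ^^ (ρ' (bxor (bxor x' u₁) u₂) ^^ ρ' (bxor (bxor (bxor x' u₁) u₂) u₃)))) := by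
  intro ρ ρ'
  have e1 := tcc_third_rho κ v u₁ u₂ u₃ x
  have e2 := tcc_third_rho κ v' u₁ u₂ u₃ x'
  simp only at e1 e2
  rw [e1, e2]
  exact tcf_third_const κ hκ _ _ _ _ _

/-- **Light structure (`G|_{H×H} = ε·ω`).**  See the module docstring. [this work] -/
theorem tls_light_structure (κ : (Fin (3 + (1 + 8)) → Bool) → Bool) (hκ : IsDegLeFun 3 κ) (v₀ : Fin 3 → Bool)
    (h : ℕ) (hh3 : 3 ≤ h) (lo hi : Fin h → Fin 8)
    (hlo : Function.Injective lo) (hhi : Function.Injective hi) (hlohi : ∀ i j, lo i ≠ hi j)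
    (ω' : (Fin 8 → Bool) → (Fin 8 → Bool) → Bool)
    (hω' : ∀ v w, ω' v w = decide ((∑ i : Fin h, ((if v (lo i) = true then (1 : ZMod 2) else 0) * (if w (hi i) = true then (1 : ZMod 2) else 0) +
        (if v (hi i) = true then (1 : ZMod 2) else 0) * (if w (lo i) = true then (1 : ZMod 2) else 0))) = 1))
    (hT : ∀ u v w x : Fin (1 + 8) → Bool,
      ((((fun s => κ (Fin.append v₀ s)) x ^^ (fun s => κ (Fin.append v₀ s)) (bxor x w)) ^^
          ((fun s => κ (Fin.append v₀ s)) (bxor x v) ^^ (fun s => κ (Fin.append v₀ s)) (bxor (bxor x v) w))) ^^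
        (((fun s => κ (Fin.append v₀ s)) (bxor x u) ^^ (fun s => κ (Fin.append v₀ s)) (bxor (bxor x u) w)) ^^
          ((fun s => κ (Fin.append v₀ s)) (bxor (bxor x u) v) ^^ (fun s => κ (Fin.append v₀ s)) (bxor (bxor (bxor x u) v) w)))) =
        (((u (Fin.castAdd 8 (0 : Fin 1)) && ω' (fun j => v (Fin.natAdd 1 j)) (fun j => w (Fin.natAdd 1 j))) ^^
            (v (Fin.castAdd 8 (0 : Fin 1)) && ω' (fun j => u (Fin.natAdd 1 j)) (fun j => w (Fin.natAdd 1 j)))) ^^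
          (w (Fin.castAdd 8 (0 : Fin 1)) && ω' (fun j => u (Fin.natAdd 1 j)) (fun j => v (Fin.natAdd 1 j)))))
    (b : Bool) (hhalf : ∀ s : Fin 8 → Bool, κ (Fin.append v₀ (Fin.append ![!b] s)) = false)
    (t : Fin 3) (hwt : #(univ.filter fun y : Fin (1 + 8) → Bool => κ (Fin.append (bxor v₀ (fun l => decide (l = t))) y) = true) < 160) :
    ∃ ε : Bool, ∀ σ τ : Fin 8,
      (((κ (Fin.append v₀ zeroVec) ^^ κ (bxor (Fin.append v₀ zeroVec) (fun l => decide (l = Fin.natAdd 3 (Fin.natAdd 1 τ))))) ^^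
          (κ (bxor (Fin.append v₀ zeroVec) (fun l => decide (l = Fin.natAdd 3 (Fin.natAdd 1 σ)))) ^^
            κ (bxor (bxor (Fin.append v₀ zeroVec) (fun l => decide (l = Fin.natAdd 3 (Fin.natAdd 1 σ))))
              (fun l => decide (l = Fin.natAdd 3 (Fin.natAdd 1 τ)))))) ^^
        ((κ (bxor (Fin.append v₀ zeroVec) (fun l => decide (l = Fin.castAdd (1 + 8) t))) ^^
            κ (bxor (bxor (Fin.append v₀ zeroVec) (fun l => decide (l = Fin.castAdd (1 + 8) t)))
              (fun l => decide (l = Fin.natAdd 3 (Fin.natAdd 1 τ))))) ^^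
          (κ (bxor (bxor (Fin.append v₀ zeroVec) (fun l => decide (l = Fin.castAdd (1 + 8) t)))
              (fun l => decide (l = Fin.natAdd 3 (Fin.natAdd 1 σ)))) ^^
            κ (bxor (bxor (bxor (Fin.append v₀ zeroVec) (fun l => decide (l = Fin.castAdd (1 + 8) t)))
              (fun l => decide (l = Fin.natAdd 3 (Fin.natAdd 1 σ)))) (fun l => decide (l = Fin.natAdd 3 (Fin.natAdd 1 τ))))))) =
      (ε && ω' (fun l => decide (l = σ)) (fun l => decide (l = τ))) := by
  classical
  -- the neighbouring cell has the same cubic form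
  set v₁ : Fin 3 → Bool := bxor v₀ (fun l => decide (l = t)) with hv₁
  have hT₁ : ∀ u v w x : Fin (1 + 8) → Bool,
      ((((fun s => κ (Fin.append v₁ s)) x ^^ (fun s => κ (Fin.append v₁ s)) (bxor x w)) ^^
          ((fun s => κ (Fin.append v₁ s)) (bxor x v) ^^ (fun s => κ (Fin.append v₁ s)) (bxor (bxor x v) w))) ^^
        (((fun s => κ (Fin.append v₁ s)) (bxor x u) ^^ (fun s => κ (Fin.append v₁ s)) (bxor (bxor x u) w)) ^^
          ((fun s => κ (Fin.append v₁ s)) (bxor (bxor x u) v) ^^ (fun s => κ (Fin.append v₁ s)) (bxor (bxor (bxor x u) v) w)))) =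
        (((u (Fin.castAdd 8 (0 : Fin 1)) && ω' (fun j => v (Fin.natAdd 1 j)) (fun j => w (Fin.natAdd 1 j))) ^^
            (v (Fin.castAdd 8 (0 : Fin 1)) && ω' (fun j => u (Fin.natAdd 1 j)) (fun j => w (Fin.natAdd 1 j)))) ^^
          (w (Fin.castAdd 8 (0 : Fin 1)) && ω' (fun j => u (Fin.natAdd 1 j)) (fun j => v (Fin.natAdd 1 j)))) := by
    intro u v w x
    rw [← hT u v w x]
    exact tls_cells_third κ hκ v₁ v₀ u v w x x
  -- halves' forms of both cells differ by `ω'`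
  obtain ⟨h3₁, hforms₁⟩ := tl2_cell_halves (fun s => κ (Fin.append v₁ s)) ω' hT₁
  obtain ⟨h3₀, hforms₀⟩ := tl2_cell_halves (fun s => κ (Fin.append v₀ s)) ω' hT
  -- the neighbour: `B₀ ≡ 0 ∨ B₁ ≡ 0` (cell lemma L2)
  have h8 := tl2_cell_eight (fun s => κ (Fin.append v₁ s)) h hh3 lo hi hlo hhi hlohi ω' hω' hT₁ hwt
  simp only at h8 hforms₁ hforms₀
  -- abbreviations for the second differences of the `0`-halves at the base point `0`
  have key₁ : ∃ ε₁ : Bool, ∀ σ τ : Fin 8,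
      ((κ (Fin.append v₁ (Fin.append ![false] zeroVec)) ^^ κ (Fin.append v₁ (Fin.append ![false] (bxor zeroVec (fun l => decide (l = τ)))))) ^^
        (κ (Fin.append v₁ (Fin.append ![false] (bxor zeroVec (fun l => decide (l = σ))))) ^^
          κ (Fin.append v₁ (Fin.append ![false] (bxor (bxor zeroVec (fun l => decide (l = σ))) (fun l => decide (l = τ))))))) =
      (ε₁ && ω' (fun l => decide (l = σ)) (fun l => decide (l = τ))) := by
    rcases h8 with h0 | h1
    · refine ⟨false, fun σ τ => ?_⟩
      rw [Bool.false_and]; exact h0 _ _ zeroVec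
    · refine ⟨true, fun σ τ => ?_⟩
      rw [Bool.true_and, ← hforms₁ (fun l => decide (l = σ)) (fun l => decide (l = τ)) zeroVec zeroVec, h1 _ _ zeroVec, Bool.xor_false]
  -- the light cell: one half vanishes
  have key₀ : ∃ ε₀ : Bool, ∀ σ τ : Fin 8,
      ((κ (Fin.append v₀ (Fin.append ![false] zeroVec)) ^^ κ (Fin.append v₀ (Fin.append ![false] (bxor zeroVec (fun l => decide (l = τ)))))) ^^
        (κ (Fin.append v₀ (Fin.append ![false] (bxor zeroVec (fun l => decide (l = σ))))) ^^
          κ (Fin.append v₀ (Fin.append ![false] (bxor (bxor zeroVec (fun l => decide (l = σ))) (fun l => decide (l = τ))))))) =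
      (ε₀ && ω' (fun l => decide (l = σ)) (fun l => decide (l = τ))) := by
    cases b
    · -- the `true`-half vanishes ⇒ `B₁ ≡ 0` ⇒ `B₀ = ω'`
      refine ⟨true, fun σ τ => ?_⟩
      have e := hforms₀ (fun l => decide (l = σ)) (fun l => decide (l = τ)) zeroVec zeroVec
      simp only [Bool.not_false] at hhalf
      simp only [hhalf, Bool.xor_false] at e
      rw [Bool.true_and]; exact e
    · -- the `false`-half vanishes ⇒ `B₀ ≡ 0`
      refine ⟨false, fun σ τ => ?_⟩
      simp only [Bool.not_true] at hhalf
      simp only [hhalf, Bool.false_and, Bool.xor_false]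
  obtain ⟨ε₁, hε₁⟩ := key₁
  obtain ⟨ε₀, hε₀⟩ := key₀
  refine ⟨ε₁ ^^ ε₀, fun σ τ => ?_⟩
  have e := tcm_mixed_third κ v₀ t σ τ
  simp only at e
  rw [e, ← hv₁, hε₁ σ τ, hε₀ σ τ]
  cases ε₁ <;> cases ε₀ <;> cases ω' (fun l => decide (l = σ)) (fun l => decide (l = τ)) <;> rfl

end Summit.QuantumAdvantage.QuantumAdvantage.Theorems.CubicForrelation.NearExactIsExact
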